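import Literature.NumberTheory.Automorphic.BCDTModularity
import Literature.NumberTheory.Automorphic.LanglandsTunnellModThree
import Literature.NumberTheory.Automorphic.CDTTheorem722
import Literature.NumberTheory.Automorphic.CDTTheorem712TwoLiftsProofs
import Literature.NumberTheory.Automorphic.LanglandsTetrahedralOfCyclicDescent
import Literature.NumberTheory.Automorphic.PiOfArtinRepFrobSatakeCompatibleProofs
import Literature.NumberTheory.EllipticCurves.NewformGaloisRepModLAssembly
import HarnessLib

/-!
# `stub_modThree` — ideator k = 3, GENERATION 17 (home family 3: probe the extremes)
# "EXTREMES OF THE LEVEL, AND THE EXACT OPEN DEBT"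

Typed companion of `STUB-IDEAS-stub_modThree-3.md` (gen 17).  Nothing here is registered; the
skeleton `Lines/Sketch.lean` (sha 21576c53) is untouched.  NO `sorry`: helper STATEMENTS are
`def … : Prop`, every `theorem` is proved.

* §1 (T-I, minimal counterexample BY LEVEL).  The conductor-minimal cell of the stub — `ρ̄ = E[3]`
  unramified outside `3` — is EMPTY in print (Serre, Œuvres III p. 710; Tate 1994 at `ℓ = 2`:
  no odd irreducible `ρ̄ : Γ_ℚ → GL₂(𝔽̄₃)` unramified outside `3`), typed as the named-fact-shaped
  `NoOddIrredModThreeUnramifiedOutsideThree`; on it the stub holds VACUOUSLY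
  (`sigStubModThree_levelOneCell`, proved from the oddness of `E[3]`).  The induction step above the
  base is Khare–Wintenberger's killing of ramification (tree monolith `khare_wintenberger`), so the
  inversion is recorded as an autopsy, not a road.
* §2 (T-II, the exact open debt).  With `frobSatakeCompatibleAt_of_isPiOfArtinRep_holds` (Gelbart
  Prop. 4.1) PROVED in the tree, the registered stub follows from exactly SEVEN open named leaves
  (`sigStubModThree_of_seven_open_leaves`, kernel-checked): automorphic induction of characters,
  cyclic descent, the Gelbart–Jacquet lift, Jacquet–Shalika rigidity, the Arthur–Clozel quadratic
  fibres, Tunnell's cubic lifts, and the weight-one dictionary (Gelbart Prop. 4.2).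
-/

set_option linter.dupNamespace false

noncomputable section

open scoped MatrixGroups Matrix NumberField ModularForm Polynomial
open Literature.NumberTheory Literature.NumberTheory.Automorphic Literature.NumberTheory.Automorphic.BCDT
open Literature.NumberTheory.GaloisRepresentations Literature.NumberTheory.GaloisRepresentations.ModPGaloisRep
open Literature.NumberTheory.EllipticCurves Literature.NumberTheory.EllipticCurves.ModularForms
open IsDedekindDomain CongruenceSubgroup

namespace Summit.ABC.ABC.Cruxes.FreyModularity.StubIdeasModThree3G17

/-- The registered stub `stub_modThree`, verbatim (`Lines/Sketch.lean` L143). [cite: Wiles1995Annals, Ch. 5] -/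
abbrev SigStubModThree : Prop :=
  ∀ (W : WeierstrassCurve ℚ) [W.IsElliptic] (ρ : ModPGaloisRep ℚ (ZMod 3) 2),
    W.IsTorsionGaloisRep 3 ρ → FramedRep.IsAbsolutelyIrreducible ρ → ρ.IsModular

/-! ## §0  `E[3]` is odd (restated from the gen-2/gen-16 companions; proved) -/

/-- `ρ̄ = E[3]` is odd: `det ρ̄ = χ̄₃` (tree: `det_eq_modPCyclotomicCharacter_of_isTorsionGaloisRep_holds`)
and `χ̄₃(c) = -1`. [folklore] -/
theorem isOdd_of_isTorsionGaloisRep_three (W : WeierstrassCurve ℚ) [W.IsElliptic]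
    (ρ : ModPGaloisRep ℚ (ZMod 3) 2) (hρ : W.IsTorsionGaloisRep 3 ρ) : FramedGaloisRep.IsOdd ρ := by
  haveI : NeZero ((3 : ℕ) : ℚ) := ⟨by norm_num⟩
  intro φ c hc
  rw [W.det_eq_modPCyclotomicCharacter_of_isTorsionGaloisRep_holds 3 ρ hρ c]
  ext
  rw [modPCyclotomicCharacterZMod_eq_modNCyclotomicCharacter,
    modNCyclotomicCharacter_of_isComplexConjugation hc, Units.val_neg, Units.val_one]

/-! ## §1  T-I: the conductor-minimal cell is empty (Serre p. 710) — typed base, vacuous cell -/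

open Rat.HeightOneSpectrum in
/-- **Serre's level-one theorem at `ℓ = 3`, `𝔽₃`-coefficients** (Serre, Œuvres III, note p. 710 to
n° 143, extending Tate 1994 from `ℓ = 2`; Khare 2007 survey §1: "the results proven by Tate and Serre
early on were for `p = 2, 3` and `N(ρ̄) = 1`"): there is no irreducible odd `ρ̄ : Γ_ℚ → GL₂(𝔽₃)`
unramified at every prime `≠ 3`.  Named-fact-SHAPED statement (NOT asserted; nothing in the tree
proves it — its proof needs Odlyzko–Poitou discriminant bounds, absent from Mathlib, whose Minkowski
bound `NumberField.abs_discr_ge'` gives rd ≥ 5.15 in degree 48 against Fontaine's ceiling 3^{3/2} = 5.196).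
[cite: Tate1994, Theorem] -/
def NoOddIrredModThreeUnramifiedOutsideThree : Prop :=
  ∀ ρ : ModPGaloisRep ℚ (ZMod 3) 2, FramedRep.IsIrreducible ρ → FramedGaloisRep.IsOdd ρ →
    (∀ v : HeightOneSpectrum (𝓞 ℚ), ((primesEquiv v : Nat.Primes) : ℕ) ≠ 3 →
      FramedGaloisRep.IsUnramifiedAt v ρ) → False

open Rat.HeightOneSpectrum in
/-- **The level-one cell of the stub is VACUOUS** given Serre's theorem: for `E/ℚ` and a framed
`ρ̄ = E[3]` unramified away from `3` (e.g. `N_E` a power of `3`, by Néron–Ogg–Shafarevich), the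
hypothesis "absolutely irreducible" is never met, so the stub's conclusion holds trivially.  This is
the base of the Khare–Wintenberger induction on the level; the STEP is `khare_wintenberger` itself.
[cite: Tate1994, Theorem] -/
theorem sigStubModThree_levelOneCell (hS : NoOddIrredModThreeUnramifiedOutsideThree) :
    ∀ (W : WeierstrassCurve ℚ) [W.IsElliptic] (ρ : ModPGaloisRep ℚ (ZMod 3) 2),
      W.IsTorsionGaloisRep 3 ρ →
      (∀ v : HeightOneSpectrum (𝓞 ℚ), ((primesEquiv v : Nat.Primes) : ℕ) ≠ 3 →
        FramedGaloisRep.IsUnramifiedAt v ρ) →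
      FramedRep.IsAbsolutelyIrreducible ρ → ρ.IsModular :=
  fun W _ ρ hρ hur habs ↦
    (hS ρ habs.isIrreducible (isOdd_of_isTorsionGaloisRep_three W ρ hρ) hur).elim

/-! ## §2  T-II: the exact open debt of the registered stub (kernel-checked) -/

/-- **The registered stub from exactly the SEVEN open named leaves** of the tree's Langlands–Tunnell
proof (`langlands_tunnell_of_six_leaves` + the PROVED Gelbart Prop. 4.1
`frobSatakeCompatibleAt_of_isPiOfArtinRep_holds` + the tree's `modThree_of_langlands_tunnell`):
automorphic induction of characters in prime degree, cyclic descent of prime degree, the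
Gelbart–Jacquet adjoint lift, Jacquet–Shalika rigidity, the fibres of quadratic base change, the
cuspidality of Tunnell's cubic lifts, and the weight-one dictionary.  Every hypothesis is an unproved
catalogued `def … : Prop`; none is restated.
[cite: Tunnell1981, Theorem] [cite: Gelbart1997, Thm. 1.3, §7.1–7.2, Props. 4.1–4.2] -/
theorem sigStubModThree_of_seven_open_leaves
    (hAI : automorphicInduction_character) (hdesc : cuspidal_descent_cyclic)
    (hGJ : GelbartJacquet_adjoint_lift) (hJS : JacquetShalika_eq_of_rsData_eq)
    (ha : ArthurClozel_fibres_quadratic) (hb : tunnell_cuspidal_cubic_lifts)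
    (hW1 : exists_isNewform1_of_isPiOfArtinRep) : SigStubModThree :=
  fun W _ ρ hρ habs ↦
    modThree_of_langlands_tunnell
      (langlands_tunnell_of_six_leaves hAI hdesc hGJ hJS ha hb
        frobSatakeCompatibleAt_of_isPiOfArtinRep_holds hW1) W ρ hρ habs

end Summit.ABC.ABC.Cruxes.FreyModularity.StubIdeasModThree3G17

end
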